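import Summits.ResolutionOfSingularities.ResolutionOfSingularities.Theorems.HilbertSamuelEliminationSigmaMaxModificationsCorridor3ConfinedSetup
import Summits.ResolutionOfSingularities.ResolutionOfSingularities.Theorems.HilbertSamuelEliminationSigmaMaxModificationsCorridor3NuGluingFinite
import Summits.ResolutionOfSingularities.ResolutionOfSingularities.Theorems.HilbertSamuelEliminationSigmaMaxModificationsCorridor3NuGluingChart
import Literature.AlgebraicGeometry.Resolution.MarkedIdeals
import Literature.AlgebraicGeometry.Resolution.BlowupSequences
import Mathlib.AlgebraicGeometry.Morphisms.ClosedImmersion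
import Mathlib.AlgebraicGeometry.PullbackCarrier
import Mathlib.FieldTheory.Perfect
import HarnessLib

/-!
# Route `HilbertSamuelElimination`, crux `SigmaMaxModificationsCorridor3`
# (stmt-ResolutionOfSingularities-19249; child of `SigmaMaxModifications` stmt-…-18506),
# line `tame_wild` v3 (confined form) — ASSEMBLY of the confined transfer, brick T1 in the
# RATIFIED form T1′ (CHAIN w42 v3.2 §0b); otherwise verbatim `confinedNu3_of_bricks_cs` (p482816)

[OURS · L1 W4.2] Re-threading of res-L1-w42-lead-1's `confinedNu3_of_bricks_cs`
(…Corridor3ConfinedAssemblyCS.lean, p482816) with the brick T1 taken in the ratified form T1′ —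
its hypothesis `hT1` carries the two extra antecedents `[IsLocallyNoetherian Z]` and
`ν ≠ Φ^{(3)}` (both held at the only call site: the tower top `Z'` is of finite type over `k`, and
`ν = hypersurfaceHF m` with `m ≥ 2`; the frame now takes `ν ≠ iterPSum 3 Phi`, a hypothesis of the
registered stub). The landed brick is `Helpers.stub_T1_chartTransfer`
(…Corridor3ChartTransfer.lean, res-L1-w42-stub-4). Proof body otherwise byte-identical.
Original description: kernel check of the architecture of the registered stub
`stub_confinedTameNu3_of_thor4`: from the five remaining bricks T0 (bridge `IsMarkedResolution` →
`CentreSeq.IsResolutionOf`), T1 (per-chart transfer), T2 (hypersurface chart at a closed stratum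
point), T3 (embedded tower), T4 (chart dictionary) — taken here as HYPOTHESES with the exact
signatures of `L/res-L1-w42-lead-1/helpers-v3.lean` — and tame hypersurface order reduction THOR₄
at `p`, a confining sequence whose top stratum maps to FINITELY MANY closed points yields the
`ν`-modification: one hypersurface chart per image point, avoiding the other image points, so that
the traces of the top stratum on the charts are pairwise disjoint; the chart witnesses are merged by
induction over the image points (`Finset.Nonempty.cons_induction`) and glued with the identity.
Uses the landed set-up (p480065), per-chart packaging (p479629), two-chart merge (p478407), identity
witness and passage to `NuMod` (p478884), transitivity (p475565), and `CentreSeq.restrict` (tree).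
Variant of `confinedNu3_of_bricks_max` (p481325) in which tame hypersurface order reduction THOR₄ is
taken in its data-level form `∃ t : CentreSeq Z, t.IsResolutionOf (Z, I, ∅, m)` (skeleton tame_wild
v3.1), so that the bridge brick T0 (`IsMarkedResolution` → `CentreSeq`) drops out of the tame chain.
Like p481325 it SUPERSEDES `confinedNu3_of_bricks` (…ConfinedAssembly.lean, p480768), whose dictionary hypothesis
T4 was typed with the disjunction `ν ∉ Σ_Y(3) ∨ ν maximal` — FALSE in the absent branch (a reduced
plane curve point of multiplicity `m + 1` is in `supp(I, m)` with empty `ν`-stratum), hence never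
dischargeable; here T4 asks maximality only (the assembly never needed more). This is the statement of the registered stub `stub_confinedTameNu3_of_thor4` with `IsTameValue p ν`
unfolded to `ν = hypersurfaceHF m`, `2 ≤ m < p`, modulo T0–T4. NOT a statement of any manuscript; no
theorem here closes an item.

## Sources

* V. Cossart, U. Jannsen, S. Saito, LNM 2270 (2020), Def. 6.14, Rem. 6.24, Thm. 3.10 (1).
  [CossartJannsenSaito2020]
* E. Bierstone, D. Grigoriev, P. Milman, J. Włodarczyk, arXiv:1206.3090, Def. 3.1.3–3.1.5,
  Thm. 8.0.5. [BierstoneGrigorievMilmanWlodarczyk2011]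
* The Stacks Project, Tags 01LH, 080E. [StacksProject]
-/

set_option linter.dupNamespace false -- mandated namespace of this single-conjunct summit

noncomputable section

open CategoryTheory AlgebraicGeometry TopologicalSpace Topology
open Literature.AlgebraicGeometry.Resolution Literature.RingTheory.HilbertSamuel
open Summit.ResolutionOfSingularities.ResolutionOfSingularities.Theorems.SigmaMaxModifications.Sketch

namespace Summit.ResolutionOfSingularities.ResolutionOfSingularities.Theorems.SigmaMaxModificationsCorridor3.TameWild

/-- **THE CONFINED TRANSFER, modulo the bricks T1′, T2, T3, T4 and THOR₄** — verbatim
`confinedNu3_of_bricks_cs` (p482816) but for the two extra antecedents of `hT1` (ratified T1′) and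
the extra frame hypothesis `ν ≠ Φ^{(3)}` (the registered stub
`stub_confinedTameNu3_of_thor4` with the tame value unfolded to `ν = hypersurfaceHF m`,
`2 ≤ m < p`). Hypotheses `hT1 … hT4` are verbatim the typed signatures of helpers-v3; `hthor` is the
statement of `stub_thor4` at `p`. Route: set-up on `s.top` (p480065); for each image point `y` a
hypersurface chart at `y` avoiding the other image points (T2), the restricted sequence, the embedded
tower (T3), the dictionary (T4), THOR₄, the bridge (T0), the per-chart transfer (T1), the packaged
chart witness (p479629) whose trace on the top stratum is exactly the fibre over `y`; induction over
the image points merging the witnesses (p478407, traces pairwise disjoint); merge with the identity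
and passage to `NuMod s.top` (p478884); composition with `s` (p475565).
[cite: CossartJannsenSaito2020, Def. 6.14, Rem. 6.24] [cite: BierstoneGrigorievMilmanWlodarczyk2011, Thm. 8.0.5]
[cite: StacksProject, Tag 01LH] -/
theorem confinedNu3_of_bricks_cs' (p : ℕ)
    -- T1: per-chart transfer
    (hT1 : ∀ (k : Type) [Field k] (Y : Scheme.{0}) (g : Y ⟶ Spec (.of k))
      [LocallyOfFiniteType g] [IsReduced Y], topologicalKrullDim Y ≤ ((3 : ℕ) : WithBot ℕ∞) →
      ∀ (ν : ℕ → ℕ), Maximal (· ∈ Scheme.hsValues Y 3) ν → ν ≠ iterPSum 3 Phi → ∀ (m : ℕ), 1 ≤ m →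
      ∀ (V : Scheme.{0}) (j : V ⟶ Y) [IsOpenImmersion j] (Z : Scheme.{0}) [IsLocallyNoetherian Z],
      Scheme.IsRegular Z →
      ∀ (I : Z.IdealSheafData), IsEffectiveCartier I → ∀ (ι : V ⟶ Z) [IsClosedImmersion ι],
      ι.ker = I →
      (⟨I, [], m⟩ : MarkedIdeal Z).support = ι.base '' Scheme.hsStratum V 3 ν →
      (∀ z : Z, idealOrder I z ≤ (m : ℕ∞)) →
      ∀ (t : CentreSeq Z), t.IsResolutionOf (⟨I, [], m⟩ : MarkedIdeal Z) →
      ∃ s : CentreSeq V, s.AllRegular ∧ s.CentresOver (Scheme.hsStratum V 3 ν) ∧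
        (∀ x' : s.top, Scheme.hsFun s.top 3 x' ≤ Scheme.hsFun V 3 (s.comp.base x')) ∧
        ν ∉ Scheme.hsValues s.top 3)
    -- T2: hypersurface chart at a closed stratum point
    (hT2 : ∀ (p : ℕ), p.Prime → ∀ (k : Type) [Field k] [CharP k p] [PerfectField k]
      (Y : Scheme.{0}) (g : Y ⟶ Spec (.of k)) [LocallyOfFiniteType g] [IsReduced Y],
      topologicalKrullDim Y ≤ ((3 : ℕ) : WithBot ℕ∞) → ∀ (ν : ℕ → ℕ),
      Maximal (· ∈ Scheme.hsValues Y 3) ν → ∀ (m : ℕ), 2 ≤ m → ν = hypersurfaceHF m →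
      ∀ (y : Y), y ∈ Scheme.hsStratum Y 3 ν → IsClosed ({y} : Set Y) →
      ∀ (A : Set Y), A.Finite → (∀ a ∈ A, IsClosed ({a} : Set Y)) → y ∉ A →
      ∃ (U : Y.Opens) (_ : y ∈ U) (Z : Scheme.{0}) (h : Z ⟶ Spec (.of k)) (I : Z.IdealSheafData)
        (ι : (U : Scheme.{0}) ⟶ Z),
        Disjoint (U : Set Y) A ∧ IsSeparated h ∧ LocallyOfFiniteType h ∧ QuasiCompact h ∧
        IsIntegral Z ∧ Scheme.IsRegular Z ∧ IsAffine Z ∧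
        topologicalKrullDim Z ≤ ((4 : ℕ) : WithBot ℕ∞) ∧ I ≠ ⊥ ∧ IsEffectiveCartier I ∧
        IsClosedImmersion ι ∧ ι ≫ h = U.ι ≫ g ∧ ι.ker = I ∧
        (⟨I, [], m⟩ : MarkedIdeal Z).support = ι.base '' Scheme.hsStratum (U : Scheme.{0}) 3 ν ∧
        ∀ z : Z, idealOrder I z ≤ (m : ℕ∞))
    -- T3: embedded tower
    (hT3 : ∀ (k : Type) [Field k] (U Z : Scheme.{0}) (h : Z ⟶ Spec (.of k))
      [IsSeparated h] [LocallyOfFiniteType h] [QuasiCompact h], IsIntegral Z →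
      Scheme.IsRegular Z → topologicalKrullDim Z ≤ ((4 : ℕ) : WithBot ℕ∞) →
      ∀ (I : Z.IdealSheafData), I ≠ ⊥ → IsEffectiveCartier I → ∀ (ι : U ⟶ Z)
      [IsClosedImmersion ι], ι.ker = I → ∀ (r : CentreSeq U), r.AllRegular →
      ∃ (Z' : Scheme.{0}) (h' : Z' ⟶ Spec (.of k)) (I' : Z'.IdealSheafData) (ι' : r.top ⟶ Z'),
        IsSeparated h' ∧ LocallyOfFiniteType h' ∧ QuasiCompact h' ∧ IsIntegral Z' ∧
        Scheme.IsRegular Z' ∧ topologicalKrullDim Z' ≤ ((4 : ℕ) : WithBot ℕ∞) ∧ I' ≠ ⊥ ∧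
        IsEffectiveCartier I' ∧ IsClosedImmersion ι' ∧ ι' ≫ h' = r.comp ≫ ι ≫ h ∧
        ι'.ker = I')
    -- T4: chart dictionary
    (hT4 : ∀ (k : Type) [Field k] (Y : Scheme.{0}) (g : Y ⟶ Spec (.of k))
      [LocallyOfFiniteType g] [IsReduced Y], topologicalKrullDim Y ≤ ((3 : ℕ) : WithBot ℕ∞) →
      ∀ (ν : ℕ → ℕ) (m : ℕ), 1 ≤ m → ν = hypersurfaceHF m →
      Maximal (· ∈ Scheme.hsValues Y 3) ν →
      ∀ (V : Scheme.{0}) (j : V ⟶ Y) [IsOpenImmersion j] (Z : Scheme.{0}), Scheme.IsRegular Z →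
      topologicalKrullDim Z ≤ ((4 : ℕ) : WithBot ℕ∞) → ∀ (I : Z.IdealSheafData), I ≠ ⊥ →
      IsEffectiveCartier I → ∀ (ι : V ⟶ Z) [IsClosedImmersion ι], ι.ker = I →
      (⟨I, [], m⟩ : MarkedIdeal Z).support = ι.base '' Scheme.hsStratum V 3 ν ∧
        ∀ z : Z, idealOrder I z ≤ (m : ℕ∞))
    -- THOR₄ at `p`, data-level (`CentreSeq`) form
    (hthor : ∀ (k : Type) [Field k] [CharP k p] [PerfectField k] (Z : Scheme.{0})
      (h : Z ⟶ Spec (.of k)), IsSeparated h → LocallyOfFiniteType h → QuasiCompact h →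
      IsIntegral Z → Scheme.IsRegular Z → topologicalKrullDim Z ≤ ((4 : ℕ) : WithBot ℕ∞) →
      ∀ (I : Z.IdealSheafData), I ≠ ⊥ → IsEffectiveCartier I → ∀ m : ℕ, 1 ≤ m → m < p →
        ∃ t : CentreSeq Z, t.IsResolutionOf (⟨I, [], m⟩ : MarkedIdeal Z))
    -- the frame
    (hp : p.Prime) (k : Type) [Field k] [CharP k p] [PerfectField k] (Y : Scheme.{0})
    (g : Y ⟶ Spec (.of k)) [LocallyOfFiniteType g] [QuasiCompact g] [IsReduced Y]
    (hd3 : topologicalKrullDim Y ≤ ((3 : ℕ) : WithBot ℕ∞)) (ν : ℕ → ℕ)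
    (hν : Maximal (· ∈ Scheme.hsValues Y 3) ν) (m : ℕ) (hm2 : 2 ≤ m) (hmp : m < p)
    (hνm : ν = hypersurfaceHF m) (hνΦ : ν ≠ iterPSum 3 Phi)
    -- the confining sequence, over ONE closed point
    (s : CentreSeq Y) (hreg : s.AllRegular) (hover : s.CentresOver (Scheme.hsStratum Y 3 ν))
    (hmono : ∀ x' : s.top, Scheme.hsFun s.top 3 x' ≤ Scheme.hsFun Y 3 (s.comp.base x'))
    (hfin : ((fun x' => s.comp.base x') '' Scheme.hsStratum s.top 3 ν).Finite)
    (hclosed : ∀ y ∈ (fun x' => s.comp.base x') '' Scheme.hsStratum s.top 3 ν,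
      IsClosed ({y} : Set Y)) :
    NuMod Y 3 3 ν := by
  haveI : IsLocallyNoetherian Y := LocallyOfFiniteType.isLocallyNoetherian g
  have hm1 : 1 ≤ m := by omega
  -- Step 1: set-up on `s.top`
  rcases nuMod_or_setup_top g hd3 hd3 hν s hover hmono with hdone | ⟨hmax', hcl, hsred, hsd, -, hlft, hqc⟩
  · exact hdone
  haveI := hsred
  haveI := hlft
  haveI := hqc
  haveI : IsLocallyNoetherian s.top := LocallyOfFiniteType.isLocallyNoetherian (s.comp ≫ g)
  set S' := Scheme.hsStratum s.top 3 ν with hS'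
  let Zc : s.top.Opens := ⟨S'ᶜ, hcl.isOpen_compl⟩
  have hZc : ((Zc : s.top.Opens) : Set s.top) = S'ᶜ := rfl
  set A : Finset Y := hfin.toFinset with hA
  have hAmem : ∀ y, y ∈ A ↔ y ∈ (fun x' => s.comp.base x') '' S' := fun y =>
    Set.Finite.mem_toFinset hfin
  -- image points lie in `Y(ν)` and are closed
  have hAstr : ∀ y ∈ A, y ∈ Scheme.hsStratum Y 3 ν := by
    intro y hy
    obtain ⟨x₀, hx₀, rfl⟩ := (hAmem y).mp hy
    rw [Scheme.mem_hsStratum_iff] at hx₀ ⊢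
    have h1 : ν ≤ Scheme.hsFun Y 3 (s.comp.base x₀) := hx₀ ▸ hmono x₀
    exact le_antisymm (hν.2 ⟨_, rfl⟩ h1) h1
  have hAcl : ∀ y ∈ A, IsClosed ({y} : Set Y) := fun y hy => hclosed y ((hAmem y).mp hy)
  -- Step 2: one chart witness per image point, with trace exactly the fibre
  have chart : ∀ y ∈ A, ∃ (Wn : Scheme.{0}) (a : Wn ⟶ s.top) (V : s.top.Opens),
      (∀ x' ∈ S', s.comp.base x' = y → x' ∈ V) ∧ (∀ x' ∈ V, x' ∈ S' → s.comp.base x' = y) ∧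
        IsLocallyNoetherian Wn ∧ (∀ w, a w ∈ V) ∧
          (∀ x ∈ V, ∃ W : s.top.Opens, x ∈ W ∧ IsProper (a ∣_ W)) ∧ IsReduced Wn ∧
          topologicalKrullDim Wn ≤ ((3 : ℕ) : WithBot ℕ∞) ∧
          topologicalKrullDim Wn ≤ ((3 : ℕ) : WithBot ℕ∞) ∧
          IsIso (a ∣_ (V ⊓ Zc)) ∧
          (∀ O : s.top.Opens, Dense (O : Set s.top) → (O : Set s.top) ⊆ (Scheme.hsStratum s.top 3 ν)ᶜ →
            Dense ((a ⁻¹ᵁ O : Wn.Opens) : Set Wn)) ∧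
          (∀ w : Wn, Scheme.hsFun Wn 3 w ≤ Scheme.hsFun s.top 3 (a w)) ∧
          ν ∉ Scheme.hsValues Wn 3 := by
    intro y hyA
    -- a hypersurface chart at `y` avoiding the other image points
    have hfin' : ((A : Set Y) \ {y}).Finite := (A.finite_toSet).subset Set.sdiff_subset
    obtain ⟨U, hyU, Z, h, I, ι, hdisj, hsep, hlftZ, hqcZ, hZi, hZ, -, hdimZ, hI0, hI, hιc, hιh,
      hker, -, -⟩ := hT2 p hp k Y g hd3 ν hν m hm2 hνm y (hAstr y hyA) (hAcl y hyA)
        ((A : Set Y) \ {y}) hfin' (fun a ha => hAcl a ha.1) (fun h => h.2 rfl)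
    haveI := hsep; haveI := hlftZ; haveI := hqcZ; haveI := hιc
    -- restrict the confining sequence over the chart
    let r : CentreSeq (U : Scheme.{0}) := s.restrict U.ι
    have hr : r.AllRegular := CentreSeq.AllRegular.restrict s U.ι hreg
    let j : r.top ⟶ s.top := s.restrictι U.ι
    haveI : IsOpenImmersion j := CentreSeq.isOpenImmersion_restrictι s U.ι
    have hjcomp : ∀ q : r.top, s.comp.base (j q) = U.ι (r.comp q) := fun q => by
      have e := CentreSeq.restrict_comp s U.ι
      have e' := congrArg (fun φ => φ.base q) e
      simp only [Scheme.Hom.comp_base, TopCat.coe_comp, Function.comp_apply] at e'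
      exact e'.symm
    -- climb the embedded tower, dictionary, THOR₄, bridge, transfer
    obtain ⟨Z', h', I', ι', hsep', hlft', hqc', hZi', hZ', hdimZ', hI0', hI', hιc', hιh', hker'⟩ :=
      hT3 k (U : Scheme.{0}) Z h hZi hZ hdimZ I hI0 hI ι hker r hr
    haveI := hιc'
    obtain ⟨hsupp', hord'⟩ := hT4 k s.top (s.comp ≫ g) hsd ν m hm1 hνm hmax' r.top j Z'
      hZ' hdimZ' I' hI0' hI' ι' hker'
    obtain ⟨t, ht⟩ := hthor k Z' h' hsep' hlft' hqc' hZi' hZ' hdimZ' I' hI0' hI' m hm1 hmp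
    haveI := hlft'
    haveI : IsLocallyNoetherian Z' := LocallyOfFiniteType.isLocallyNoetherian h'
    obtain ⟨s₁, hreg₁, hover₁, hmono₁, hkill₁⟩ :=
      hT1 k s.top (s.comp ≫ g) hsd ν hmax' hνΦ m hm1 r.top j Z' hZ' I' hI' ι' hker' hsupp' hord' t ht
    -- package
    obtain ⟨hnW, hrW, hpW, hredW, hdW, hNW, hisoW, hdenseW, hmonoW, hkillW⟩ :=
      localWitness_of_centreSeq_openImmersion s.top 3 3 ν hsd hsd Zc hZc.le r.top j s₁ hover₁ hmono₁
        hkill₁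
    refine ⟨s₁.top, s₁.comp ≫ j, j.opensRange, fun x' hx' hyx' => ?_, fun x' hx' hx'S => ?_, hnW, hrW,
      hpW, hredW, hdW, hNW, hisoW, hdenseW, hmonoW, hkillW⟩
    · -- the fibre of the top stratum over `y` lies in the chart
      obtain ⟨q, hq, -⟩ := Scheme.exists_preimage_of_isPullback
        (CentreSeq.isPullback_restrict s U.ι) x' ⟨y, hyU⟩ (by rw [hyx']; rfl)
      exact Scheme.Hom.mem_opensRange.mpr ⟨q, hq⟩
    · -- the trace of the top stratum on the chart lies over `y`
      obtain ⟨q, rfl⟩ := Scheme.Hom.mem_opensRange.mp hx'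
      have hU : s.comp.base (j q) ∈ (U : Set Y) := by rw [hjcomp q]; exact (r.comp q).2
      have hAq : s.comp.base (j q) ∈ (A : Set Y) := (hAmem _).mpr ⟨j q, hx'S, rfl⟩
      by_contra hne
      exact Set.disjoint_left.mp hdisj hU ⟨hAq, hne⟩
  -- Step 3: induction over the image points — merged witnesses over growing unions of charts
  have main : ∀ B : Finset Y, B.Nonempty → B ⊆ A → ∃ (Wn : Scheme.{0}) (a : Wn ⟶ s.top)
      (V : s.top.Opens),
      (∀ x' ∈ S', s.comp.base x' ∈ B → x' ∈ V) ∧ (∀ x' ∈ V, x' ∈ S' → s.comp.base x' ∈ B) ∧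
        IsLocallyNoetherian Wn ∧ (∀ w, a w ∈ V) ∧
          (∀ x ∈ V, ∃ W : s.top.Opens, x ∈ W ∧ IsProper (a ∣_ W)) ∧ IsReduced Wn ∧
          topologicalKrullDim Wn ≤ ((3 : ℕ) : WithBot ℕ∞) ∧
          topologicalKrullDim Wn ≤ ((3 : ℕ) : WithBot ℕ∞) ∧
          IsIso (a ∣_ (V ⊓ Zc)) ∧
          (∀ O : s.top.Opens, Dense (O : Set s.top) → (O : Set s.top) ⊆ (Scheme.hsStratum s.top 3 ν)ᶜ →
            Dense ((a ⁻¹ᵁ O : Wn.Opens) : Set Wn)) ∧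
          (∀ w : Wn, Scheme.hsFun Wn 3 w ≤ Scheme.hsFun s.top 3 (a w)) ∧
          ν ∉ Scheme.hsValues Wn 3 := by
    intro B hB
    induction hB using Finset.Nonempty.cons_induction with
    | singleton y =>
      intro hyA
      obtain ⟨Wn, a, V, hin, hout, hw⟩ := chart y (hyA (Finset.mem_singleton_self y))
      refine ⟨Wn, a, V, fun x' hx' hB => hin x' hx' (Finset.mem_singleton.mp hB), fun x' hx' hx'S => ?_,
        hw⟩
      exact Finset.mem_singleton.mpr (hout x' hx' hx'S)
    | cons y B hyB hB ih =>
      intro hsub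
      have hyA : y ∈ A := hsub (Finset.mem_cons_self y B)
      have hBA : B ⊆ A := fun b hb => hsub (Finset.mem_cons.mpr (Or.inr hb))
      obtain ⟨W₁, a₁, V₁, hin₁, hout₁, hn₁, hr₁, hp₁, hred₁, hd₁, hN₁, hiso₁, hdense₁, hmono₁,
        hkill₁⟩ := ih hBA
      obtain ⟨W₂, a₂, V₂, hin₂, hout₂, hn₂, hr₂, hp₂, hred₂, hd₂, hN₂, hiso₂, hdense₂, hmono₂,
        hkill₂⟩ := chart y hyA
      -- the traces are disjoint: a point of `V₁ ∩ V₂` in the stratum would lie over `B` and over `y`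
      have h12 : V₁ ⊓ V₂ ≤ Zc := by
        intro x' hx'
        show x' ∈ S'ᶜ
        intro hx'S
        have hb : s.comp.base x' ∈ B := hout₁ x' hx'.1 hx'S
        have hy' : s.comp.base x' = y := hout₂ x' hx'.2 hx'S
        exact hyB (hy' ▸ hb)
      obtain ⟨Wn, a, hn, hr', hp', hred, hd, hN, hiso, hdense, hmono', hkill⟩ :=
        exists_localWitness_sup s.top 3 3 ν Zc V₁ V₂ h12 W₁ a₁ hn₁ hr₁ hp₁ hred₁ hd₁ hN₁ hiso₁
          hdense₁ hmono₁ hkill₁ W₂ a₂ hn₂ hr₂ hp₂ hred₂ hd₂ hN₂ hiso₂ hdense₂ hmono₂ hkill₂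
      refine ⟨Wn, a, V₁ ⊔ V₂, fun x' hx' hB' => ?_, fun x' hx' hx'S => ?_, hn, hr', hp', hred, hd,
        hN, hiso, hdense, hmono', hkill⟩
      · rcases Finset.mem_cons.mp hB' with rfl | hb
        · exact Opens.mem_sup.mpr (Or.inr (hin₂ x' hx' rfl))
        · exact Opens.mem_sup.mpr (Or.inl (hin₁ x' hx' hb))
      · rcases Opens.mem_sup.mp hx' with h₁ | h₂
        · exact Finset.mem_cons.mpr (Or.inr (hout₁ x' h₁ hx'S))
        · exact Finset.mem_cons.mpr (Or.inl (hout₂ x' h₂ hx'S))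
  -- Step 4: all image points at once; the union of charts contains the top stratum
  obtain ⟨x₀, hx₀⟩ := hmax'.1
  have hx₀S : x₀ ∈ S' := by rw [hS', Scheme.mem_hsStratum_iff]; exact hx₀
  have hAne : A.Nonempty := ⟨s.comp.base x₀, (hAmem _).mpr ⟨x₀, hx₀S, rfl⟩⟩
  obtain ⟨W₁, a₁, V₁, hin₁, -, hn₁, hr₁, hp₁, hred₁, hd₁, hN₁, hiso₁, hdense₁, hmono₁, hkill₁⟩ :=
    main A hAne subset_rfl
  have hcov : Zc ⊔ V₁ = ⊤ := by
    ext x'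
    simp only [Opens.coe_sup, Opens.coe_top, Set.mem_univ, iff_true]
    by_cases hx' : x' ∈ S'
    · exact Or.inr (hin₁ x' hx' ((hAmem _).mpr ⟨x', hx', rfl⟩))
    · exact Or.inl hx'
  -- Step 5: merge with the identity of `Zc`, pass to `NuMod s.top`, compose with `s`
  obtain ⟨hn₂, hr₂, hp₂, hred₂, hd₂, hN₂, hiso₂, hdense₂, hmono₂, hkill₂⟩ :=
    localWitness_compl s.top 3 3 ν hsd hsd Zc hZc
  obtain ⟨W, a, -, -, hpa, hreda, hda, hNa, hisoa, hdensea, hmonoa, hkilla⟩ :=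
    exists_localWitness_sup s.top 3 3 ν Zc V₁ Zc inf_le_right W₁ a₁ hn₁ hr₁ hp₁ hred₁ hd₁ hN₁ hiso₁
      hdense₁ hmono₁ hkill₁ (Zc : Scheme.{0}) Zc.ι hn₂ hr₂ hp₂ hred₂ hd₂ hN₂ hiso₂ hdense₂ hmono₂ hkill₂
  have htop : V₁ ⊔ Zc = ⊤ := by rw [sup_comm]; exact hcov
  have hNuTop : NuMod s.top 3 3 ν := by
    refine nuMod_of_localWitness_top s.top 3 3 ν Zc hZc W a (fun x => ?_) hreda hda hNa
      (isIso_morphismRestrict_of_le a hisoa (le_inf le_sup_right le_rfl)) hdensea hmonoa hkilla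
    have hx : x ∈ V₁ ⊔ Zc := by rw [htop]; exact Opens.mem_top x
    exact hpa x hx
  exact nuMod_of_centreSeq_of_nuMod 3 3 hd3 ν hν s hover hmono hNuTop

end Summit.ResolutionOfSingularities.ResolutionOfSingularities.Theorems.SigmaMaxModificationsCorridor3.TameWild

end
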